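import Summits.ValiantsHypothesis.Statement
import Summits.ValiantsHypothesis.ValiantsHypothesis.Theorems.OrderedCountWindowRungs
import Literature.Computability.AlgebraicComplexity.ArithCircuitProofs
import Literature.Computability.AlgebraicComplexity.IMMInVPProofs
import Literature.Computability.AlgebraicComplexity.AutomatonIMM
import Literature.Computability.AlgebraicComplexity.FSV2018ROABP
import Literature.Computability.AlgebraicComplexity.ValiantConjectureEquivProofs
import HarnessLib

/-!
# OrderedCountWindowNecessity — `VP ≠ VNP → A_t` for EVERY support function `t` (kernel)
(decomp-valiant lens 6, gen 6; companion of `Theorems.OrderedCountWindow` / `…Rungs`)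

A sum of `t` ordered set-multilinear ABPs of total width `W` for `per_n` (coefficient-tensor form
`IsSumOrdered`) is a circuit of size `poly(n, W)`: each program `(σ, C, u, v)` is the polynomial
`uᵀ L_0 ⋯ L_{n-1} v` with `L_p = ∑_row C_{p,row} X_(row, σ p)` (`progPoly`; its coefficients ARE the
word tensor, `progPoly_eq_sum`, by the path expansion `dotProduct_listProd_mulVec`), which is
`IMM_{w,n+1}` under a linear substitution (`aeval_progSubst_immPoly`), hence has complexity
`O(w³ n + w² n²)` (`complexity_aeval_le`, `complexity_immPoly_le`); and `per_n = ∑_J perWord(J) ∏_c X_(J c,c)`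
(`perPoly_eq_sum_perWord`).  So a polynomial-width family gives `per ∈ VP`, i.e. `VP = VNP`
(`isPComputable_perPoly_complex_iff`): `perNotSumOrdered_of_vh`.  Consequently `A_t` is WEAKER than
the summit for every `t` and the exact residual `A_t → VH` is zero-sum (`summit_iff_split`).
Nothing here proves `VP ≠ VNP`. [folklore] [cite: ArvindRaja2016, §3]
-/

noncomputable section

namespace Summit.ValiantsHypothesis.ValiantsHypothesis.Theorems.OrderedCountWindow

open Literature.Computability.AlgebraicComplexity Matrix

variable {F : Type*} [Field F]

/-! ## Ordered programs are circuits -/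

section Necessity

open MvPolynomial

variable {n w : ℕ}

/-- Layer `p` of an ordered program `(σ, C)` as a `w × w` matrix of linear forms: entry `(a, b)` is
`∑_row C_{p,row}[a, b] · X_(row, σ p)` (in position `p` the program reads a variable of column `σ p`).
[cite: ArvindRaja2016, §3 (ROABPs)] -/
def layerPoly (σ : Equiv.Perm (Fin n)) (C : Fin n → Fin n → Matrix (Fin w) (Fin w) F) (p : Fin n) :
    Matrix (Fin w) (Fin w) (MvPolynomial (Fin n × Fin n) F) :=
  Matrix.of fun a b => ∑ row : Fin n, MvPolynomial.C (C p row a b) * X (row, σ p)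

/-- The polynomial of the ordered program `(σ, C, u, v)`: `uᵀ · L_0 ⋯ L_{n-1} · v`.
[cite: ArvindRaja2016, §3 (ROABPs)] -/
def progPoly (σ : Equiv.Perm (Fin n)) (C : Fin n → Fin n → Matrix (Fin w) (Fin w) F)
    (u v : Fin w → F) : MvPolynomial (Fin n × Fin n) F :=
  (fun a => MvPolynomial.C (u a)) ⬝ᵥ
    ((List.ofFn (layerPoly σ C)).prod *ᵥ fun a => MvPolynomial.C (v a))

/-- COEFFICIENTS of the program polynomial (path expansion `dotProduct_listProd_mulVec` on both
sides): `progPoly = ∑_K (uᵀ C_0[K 0] ⋯ C_{n-1}[K (n-1)] v) · ∏_p X_(K p, σ p)` — the coefficient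
tensor of an ordered program is the word tensor of its transfer matrices. [folklore] -/
theorem progPoly_eq_sum (σ : Equiv.Perm (Fin n)) (C : Fin n → Fin n → Matrix (Fin w) (Fin w) F)
    (u v : Fin w → F) :
    progPoly σ C u v = ∑ K : Fin n → Fin n,
      MvPolynomial.C (u ⬝ᵥ ((List.ofFn fun p => C p (K p)).prod *ᵥ v)) *
        ∏ p, (X (K p, σ p) : MvPolynomial (Fin n × Fin n) F) := by
  classical
  have hL : ∀ q : Fin (n + 1) → Fin w,
      MvPolynomial.C (u (q 0)) * (∏ p : Fin n, layerPoly σ C p (q p.castSucc) (q p.succ)) *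
          MvPolynomial.C (v (q (Fin.last n)))
        = ∑ K : Fin n → Fin n, MvPolynomial.C (u (q 0)) *
            (∏ p : Fin n, MvPolynomial.C (C p (K p) (q p.castSucc) (q p.succ))) *
            MvPolynomial.C (v (q (Fin.last n))) *
              ∏ p, (X (K p, σ p) : MvPolynomial (Fin n × Fin n) F) := by
    intro q
    simp only [layerPoly, Matrix.of_apply]
    rw [Fintype.prod_sum, Finset.mul_sum, Finset.sum_mul]
    refine Finset.sum_congr rfl fun K _ => ?_
    rw [Finset.prod_mul_distrib]
    ring
  have hR : ∀ K : Fin n → Fin n,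
      MvPolynomial.C (u ⬝ᵥ ((List.ofFn fun p => C p (K p)).prod *ᵥ v)) *
          ∏ p, (X (K p, σ p) : MvPolynomial (Fin n × Fin n) F)
        = ∑ q : Fin (n + 1) → Fin w, MvPolynomial.C (u (q 0)) *
            (∏ p : Fin n, MvPolynomial.C (C p (K p) (q p.castSucc) (q p.succ))) *
            MvPolynomial.C (v (q (Fin.last n))) *
              ∏ p, (X (K p, σ p) : MvPolynomial (Fin n × Fin n) F) := by
    intro K
    rw [dotProduct_listProd_mulVec, map_sum, Finset.sum_mul]
    refine Finset.sum_congr rfl fun q _ => ?_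
    rw [map_mul, map_mul, map_prod]
  unfold progPoly
  rw [dotProduct_listProd_mulVec]
  simp only [hL, hR]
  exact Finset.sum_comm

/-- The substitution turning `IMM_{w, n+1}` into the program polynomial: layer `0 ↦ v uᵀ`
(constants), layer `p + 1 ↦ L_p`. [folklore] -/
def progSubst (σ : Equiv.Perm (Fin n)) (C : Fin n → Fin n → Matrix (Fin w) (Fin w) F)
    (u v : Fin w → F) : Fin (n + 1) × Fin w × Fin w → MvPolynomial (Fin n × Fin n) F :=
  fun x => Fin.cases (motive := fun _ => MvPolynomial (Fin n × Fin n) F)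
    (MvPolynomial.C (v x.2.1 * u x.2.2)) (fun p => layerPoly σ C p x.2.1 x.2.2) x.1

/-- `progPoly = IMM_{w,n+1}(v uᵀ, L_0, …, L_{n-1})` (`aeval` is a trace of a matrix product,
`LayeredAutomaton.aeval_immPoly_eq_trace`; `tr (v uᵀ P) = uᵀ P v`). [folklore] -/
theorem aeval_progSubst_immPoly (σ : Equiv.Perm (Fin n))
    (C : Fin n → Fin n → Matrix (Fin w) (Fin w) F) (u v : Fin w → F) :
    aeval (progSubst σ C u v) (immPoly w (n + 1) F) = progPoly σ C u v := by
  rw [LayeredAutomaton.aeval_immPoly_eq_trace]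
  have hlist : ((List.finRange (n + 1)).map fun t =>
      (Matrix.of fun i j => progSubst σ C u v (t, i, j) :
        Matrix (Fin w) (Fin w) (MvPolynomial (Fin n × Fin n) F)))
      = vecMulVec (fun a => MvPolynomial.C (v a)) (fun a => MvPolynomial.C (u a)) ::
          List.ofFn (layerPoly σ C) := by
    rw [← List.ofFn_eq_map, List.ofFn_succ]
    congr 1
    ext i j
    simp [progSubst, vecMulVec_apply]
  rw [hlist, List.prod_cons, vecMulVec_mul, trace_vecMulVec, progPoly, dotProduct_mulVec,
    dotProduct_comm]

/-- **An ordered program of width `w` on `n` columns is a circuit of size `O(w³ n + w² n²)`**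
(through `IMM_{w,n+1}`, `complexity_aeval_le` + `complexity_immPoly_le`). [folklore] -/
theorem complexity_progPoly_le (σ : Equiv.Perm (Fin n))
    (C : Fin n → Fin n → Matrix (Fin w) (Fin w) F) (u v : Fin w → F) :
    complexity (progPoly σ C u v) ≤ w + 2 * w ^ 3 * (n + 1) + (n + 1) * (w * w) * (2 * n) := by
  classical
  rw [← aeval_progSubst_immPoly]
  refine (complexity_aeval_le _ _).trans (Nat.add_le_add (complexity_immPoly_le F w (n + 1)) ?_)
  have hent : ∀ x : Fin (n + 1) × Fin w × Fin w, complexity (progSubst σ C u v x) ≤ 2 * n := by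
    rintro ⟨t, a, b⟩
    refine Fin.cases (motive := fun t => complexity (progSubst σ C u v (t, a, b)) ≤ 2 * n)
      ?_ (fun p => ?_) t
    · simp only [progSubst, Fin.cases_zero]
      rw [complexity_C_holds]
      exact Nat.zero_le _
    · simp only [progSubst, Fin.cases_succ, layerPoly, Matrix.of_apply]
      refine (complexity_finset_sum_le _ _).trans ?_
      rw [Finset.card_univ, Fintype.card_fin]
      have h1 : ∀ row : Fin n,
          complexity (MvPolynomial.C (C p row a b) * X (row, σ p) : MvPolynomial (Fin n × Fin n) F)
            ≤ 1 := by
        intro row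
        have h := complexity_mul_le_holds (MvPolynomial.C (C p row a b))
          (X (row, σ p) : MvPolynomial (Fin n × Fin n) F)
        rw [complexity_C_holds, complexity_X_holds] at h
        simpa using h
      calc ∑ row, complexity (MvPolynomial.C (C p row a b) * X (row, σ p) :
              MvPolynomial (Fin n × Fin n) F) + n
          ≤ ∑ _row : Fin n, 1 + n := Nat.add_le_add_right (Finset.sum_le_sum fun row _ => h1 row) n
        _ = 2 * n := by
          rw [Finset.sum_const, Finset.card_univ, Fintype.card_fin, smul_eq_mul, mul_one, two_mul]
  calc ∑ x, complexity (progSubst σ C u v x) ≤ ∑ _x : Fin (n + 1) × Fin w × Fin w, 2 * n :=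
        Finset.sum_le_sum fun x _ => hent x
    _ = (n + 1) * (w * w) * (2 * n) := by
        rw [Finset.sum_const, Finset.card_univ, smul_eq_mul, Fintype.card_prod, Fintype.card_prod,
          Fintype.card_fin, Fintype.card_fin]

/-- **The monomial expansion of the permanent through Nisan's word tensor**:
`per_n = ∑_J perWord(J) · ∏_c X_(J c, c)` (`J` = column ↦ row). [cite: Nisan1991Noncommutative, §4] -/
theorem perPoly_eq_sum_perWord (n : ℕ) :
    perPoly (Fin n) F = ∑ J : Fin n → Fin n,
      MvPolynomial.C (NisanPermanent.perWord F n J) * ∏ c, (X (J c, c) : MvPolynomial (Fin n × Fin n) F) := by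
  classical
  have hrhs : ∑ J : Fin n → Fin n, MvPolynomial.C (NisanPermanent.perWord F n J) *
        ∏ c, (X (J c, c) : MvPolynomial (Fin n × Fin n) F)
      = ∑ J ∈ Finset.univ.filter (fun J : Fin n → Fin n => Function.Injective J),
          ∏ c, (X (J c, c) : MvPolynomial (Fin n × Fin n) F) := by
    rw [Finset.sum_filter]
    refine Finset.sum_congr rfl fun J _ => ?_
    simp only [NisanPermanent.perWord]
    split_ifs <;> simp
  rw [hrhs, perPoly, Matrix.permanent]
  refine Finset.sum_bij' (fun π _ => ⇑π)
    (fun J hJ => Equiv.ofBijective J (Finset.mem_filter.1 hJ).2.bijective_of_finite) ?_ ?_ ?_ ?_ ?_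
  · intro π _
    exact Finset.mem_filter.2 ⟨Finset.mem_univ _, π.injective⟩
  · intro J _
    exact Finset.mem_univ _
  · intro π _
    ext c
    rfl
  · intro J _
    rfl
  · intro π _
    simp [Matrix.mvPolynomialX_apply]

/-- **Circuit size of `per_n` from a sum of ordered programs**: `L(per_n) ≤ W · β(n, W) + W` with
`β(n, W) = W + 2 W³ (n+1) + 2 n (n+1) W²` (drop the width-`0` summands — at most `W` remain — and add
up the program circuits). [folklore] -/
theorem complexity_perPoly_le_of_isSumOrdered {n t W : ℕ} (h : IsSumOrdered F n t W) :
    complexity (perPoly (Fin n) F) ≤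
      W * (W + 2 * W ^ 3 * (n + 1) + (n + 1) * (W * W) * (2 * n)) + W := by
  classical
  obtain ⟨σ, w, B, hB, hsum, hper⟩ := h
  have hB' := hB
  choose Cm um vm hCuv using hB
  set Φ : Fin t → MvPolynomial (Fin n × Fin n) F := fun i =>
    ∑ J : Fin n → Fin n, MvPolynomial.C (B i (J ∘ ⇑(σ i))) *
      ∏ c, (X (J c, c) : MvPolynomial (Fin n × Fin n) F) with hΦ
  -- `per_n = ∑ Φ i`
  have hperΦ : perPoly (Fin n) F = ∑ i, Φ i := by
    rw [perPoly_eq_sum_perWord]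
    simp only [hΦ]
    rw [Finset.sum_comm]
    refine Finset.sum_congr rfl fun J _ => ?_
    rw [← hper J, map_sum, Finset.sum_mul]
  -- width-`0` programs contribute `0`
  let S : Finset (Fin t) := Finset.univ.filter fun i => w i ≠ 0
  have hΦ0 : ∀ i, i ∉ S → Φ i = 0 := by
    intro i hi
    have hwi : w i = 0 := by simpa [S] using hi
    have hBi : B i = 0 := eq_zero_of_hasNcABPWidthLE_zero (hwi ▸ hB' i)
    simp [hΦ, hBi]
  have hperS : perPoly (Fin n) F = ∑ i ∈ S, Φ i := by
    rw [hperΦ]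
    exact (Finset.sum_subset (Finset.subset_univ S) fun i _ hi => hΦ0 i hi).symm
  -- each `Φ i` is the polynomial of program `i`
  have hΦprog : ∀ i, Φ i = progPoly (σ i) (Cm i) (um i) (vm i) := by
    intro i
    let e : (Fin n → Fin n) ≃ (Fin n → Fin n) :=
      { toFun := fun J => J ∘ ⇑(σ i)
        invFun := fun K => K ∘ ⇑(σ i).symm
        left_inv := fun J => by ext c; simp
        right_inv := fun K => by ext c; simp }
    calc Φ i = ∑ J : Fin n → Fin n, MvPolynomial.C (B i (J ∘ ⇑(σ i))) *
          ∏ c, (X (J c, c) : MvPolynomial (Fin n × Fin n) F) := by simp only [hΦ]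
      _ = ∑ J : Fin n → Fin n, (fun K : Fin n → Fin n => MvPolynomial.C (B i K) *
            ∏ p, (X (K p, σ i p) : MvPolynomial (Fin n × Fin n) F)) (e J) := by
          refine Finset.sum_congr rfl fun J _ => ?_
          show _ = MvPolynomial.C (B i (J ∘ ⇑(σ i))) * ∏ p, (X ((J ∘ ⇑(σ i)) p, σ i p) : MvPolynomial _ F)
          rw [← Equiv.prod_comp (σ i) (fun c => (X (J c, c) : MvPolynomial (Fin n × Fin n) F))]
          rfl
      _ = ∑ K : Fin n → Fin n, MvPolynomial.C (B i K) *
            ∏ p, (X (K p, σ i p) : MvPolynomial (Fin n × Fin n) F) :=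
          Equiv.sum_comp e (fun K : Fin n → Fin n => MvPolynomial.C (B i K) *
            ∏ p, (X (K p, σ i p) : MvPolynomial (Fin n × Fin n) F))
      _ = progPoly (σ i) (Cm i) (um i) (vm i) := by
          rw [progPoly_eq_sum]
          simp only [hCuv]
  -- sizes
  have hSW : S.card ≤ W := by
    calc S.card = ∑ i ∈ S, 1 := by simp
      _ ≤ ∑ i ∈ S, w i :=
          Finset.sum_le_sum fun i hi => Nat.one_le_iff_ne_zero.2 (Finset.mem_filter.1 hi).2
      _ ≤ ∑ i, w i := Finset.sum_le_sum_of_subset (Finset.subset_univ S)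
      _ ≤ W := hsum
  have hwW : ∀ i, w i ≤ W := fun i =>
    (Finset.single_le_sum (fun j _ => Nat.zero_le (w j)) (Finset.mem_univ i)).trans hsum
  have hΦc : ∀ i, complexity (Φ i) ≤ W + 2 * W ^ 3 * (n + 1) + (n + 1) * (W * W) * (2 * n) := by
    intro i
    rw [hΦprog i]
    refine (complexity_progPoly_le _ _ _ _).trans ?_
    have hi := hwW i
    gcongr
  calc complexity (perPoly (Fin n) F) = complexity (∑ i ∈ S, Φ i) := by rw [hperS]
    _ ≤ ∑ i ∈ S, complexity (Φ i) + S.card := complexity_finset_sum_le _ _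
    _ ≤ ∑ _i ∈ S, (W + 2 * W ^ 3 * (n + 1) + (n + 1) * (W * W) * (2 * n)) + S.card :=
        Nat.add_le_add_right (Finset.sum_le_sum fun i _ => hΦc i) _
    _ = S.card * (W + 2 * W ^ 3 * (n + 1) + (n + 1) * (W * W) * (2 * n)) + S.card := by
        rw [Finset.sum_const, smul_eq_mul]
    _ ≤ W * (W + 2 * W ^ 3 * (n + 1) + (n + 1) * (W * W) * (2 * n)) + W :=
        Nat.add_le_add (Nat.mul_le_mul_right _ hSW) hSW

/-- **NECESSITY OF `A_t` FOR EVERY SUPPORT FUNCTION `t` (kernel)**: `VP ≠ VNP → PerNotSumOrdered t`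
(a polynomial-width family of sums of ordered programs for `per` is a polynomial-size circuit family,
so `per ∈ VP`, so `VP = VNP` by `isPComputable_perPoly_complex_iff`).  Hence `A_t` is WEAKER than
the summit for every `t`, and the exact residual `A_t → VH` is zero-sum. [folklore] -/
theorem perNotSumOrdered_of_vh (t : ℕ → ℕ) (h : _root_.ValiantsHypothesis) : PerNotSumOrdered t := by
  intro c
  by_contra hc
  push Not at hc
  refine h (isPComputable_perPoly_complex_iff.mp ?_)
  show IsPBounded fun n => complexity (perPoly (Fin n) ℂ)
  have hW : IsPBounded fun n : ℕ => n ^ c + c := ⟨c, fun n => le_rfl⟩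
  have h1 : IsPBounded fun n : ℕ => n + 1 := IsPBounded.add_holds IsPBounded.id (IsPBounded.const 1)
  have h2 : IsPBounded fun n : ℕ => 2 * n := IsPBounded.mul_holds (IsPBounded.const 2) IsPBounded.id
  have hβ : IsPBounded fun n : ℕ =>
      (n ^ c + c) * ((n ^ c + c) + 2 * (n ^ c + c) ^ 3 * (n + 1) +
        (n + 1) * ((n ^ c + c) * (n ^ c + c)) * (2 * n)) + (n ^ c + c) :=
    IsPBounded.add_holds (IsPBounded.mul_holds hW (IsPBounded.add_holds (IsPBounded.add_holds hW
      (IsPBounded.mul_holds (IsPBounded.mul_holds (IsPBounded.const 2) (IsPBounded.pow_holds hW 3)) h1))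
      (IsPBounded.mul_holds (IsPBounded.mul_holds h1 (IsPBounded.mul_holds hW hW)) h2))) hW
  exact hβ.mono fun n => complexity_perPoly_le_of_isSumOrdered (hc n)

/-- The dial iff (trivially, given necessity): `VH ↔ A_t ∧ (A_t → VH)`; the second conjunct is the
exact residual `B_t`, STRONGER than `DecompCycle1.TameOrSmLift` and not filed. [folklore] -/
theorem summit_iff_split (t : ℕ → ℕ) :
    _root_.ValiantsHypothesis ↔ PerNotSumOrdered t ∧ (PerNotSumOrdered t → _root_.ValiantsHypothesis) :=
  ⟨fun h => ⟨perNotSumOrdered_of_vh t h, fun _ => h⟩, fun h => h.2 h.1⟩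

end Necessity

end Summit.ValiantsHypothesis.ValiantsHypothesis.Theorems.OrderedCountWindow
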